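import Mathlib
import Summits.NavierStokesRegularity.NavierStokesRegularity.Theorems.TypeILiouvilleQuiescentShadow
import Summits.NavierStokesRegularity.NavierStokesRegularity.Theorems.TypeILiouvilleShadowExtraction
import Summits.NavierStokesRegularity.NavierStokesRegularity.Theorems.TypeILiouvilleTypeIliouvilleLStubOseenBallAverageMomentum
import Literature.Analysis.FluidPDE.LongLivedOseenSolution
import Literature.Analysis.FluidPDE.TypeIAncientMild
import Summits.NavierStokesRegularity.NavierStokesRegularity.Theses.SymmetryModuliCount
import Summits.NavierStokesRegularity.NavierStokesRegularity.Theses.VorticityPace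
import Summits.NavierStokesRegularity.NavierStokesRegularity.Theorems.VorticityPacePaceZoom
import HarnessLib

/-!
# TypeILiouvilleGlobalFadingAnchor — decomp-ns ROOT CELL, lens 2, generation 21 — PART 1/2 (§1 momentum anchor, §2 strata, §2b separation)

Split of the lens file `TypeILiouvilleGlobalFading.lean` (760 lines, sha256 835f24e4…; critic row 248 CLEARED KERNEL) at the §2b/§3
section boundary for the 400-line Theorems lint; bodies verbatim; the namespace is kept so every declaration keeps its name.
Part 2 (`TypeILiouvilleGlobalFading.lean`, §3–§6) imports this file. Helper for stmt-NavierStokesRegularity-10661; closes no item.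
Original module docstring:

# TypeILiouvilleGlobalFading — decomp-ns ROOT CELL, lens 2 «structural dichotomy (special vs generic)», generation 21

NODE «GLOBAL vs LOCAL FADING» — a cut of QUIESCENT LIOUVILLE `L_Q` (the residual of record of the KNSS crux
(L) = `Theses.TypeILiouville.TypeIliouvilleL` = stmt-NavierStokesRegularity-10661 after the landed g16 node
`Theorems/TypeILiouvilleQuiescentShadow.lean` + g20 `Theorems/TypeILiouvilleShadowExtraction.lean`: (L) ⟺ EL ∧ L_Q,
exact) by the boost/scale/rotation-invariant DIAL
«global slice oscillation `Osc(t) = sup_{x,y} ‖v(t,x) − v(t,y)‖` tends to 0 as `t → −∞`» (GLOBALLY FADING, GF),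
against L_Q's own hypothesis «unit-scale oscillation tends to 0» (quiescent = LOCALLY fading).

Statements are spelled INLINE over existing declarations (no `def`), exactly as in the landed QuiescentShadow file,
so that the writer can land this file verbatim as
`Summits/NavierStokesRegularity/NavierStokesRegularity/Theorems/TypeILiouvilleGlobalFading.lean --kind proof
 --supports stmt-NavierStokesRegularity-10661`.

PIECES (P = print's class: `ContinuousOn` on `t<0`, bounded, weakly div-free slices, mild heat/Oseen–Duhamel identity):
* door  **BCL «BACKWARD-CONVERGENT LIOUVILLE»**: every P-field whose slices converge UNIFORMLY to one constant
  vector as `t → −∞` is constant.  [UNDECIDED w.r.t. L_Q (BCL ⟸ L_Q proved here; converse open — test object: a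
  quiescent, globally stirred flow); leaf tag IDEA-NEEDED; contains door stmt-4050 BY NAME (§5)]
* residual **LSL «LOCALLY FADING, GLOBALLY STIRRED»**: every quiescent P-field which is NOT globally fading
  (`∃ θ>0`, at arbitrarily remote past times two points differ by `> θ`) is constant (i.e. does not exist).
  [UNDECIDED w.r.t. L_Q (LSL ⟸ L_Q proved; converse open — test object: a backward-convergent non-constant flow,
  i.e. a counterexample to BCL); leaf tags IDEA-NEEDED + INSTRUMENTABLE (§2b: its stirring lives at separation
  `≥ θ/ε(t) − 1 → ∞`)]
* hinge **MOMENTUM ANCHOR** (PROVED, §1): in P, GLOBALLY FADING ⟹ BACKWARD-CONVERGENT — conservation of the mean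
  velocity at spatial infinity (tree: `Theorems.stub_oseen_ball_average_momentum`, KNSS 2009 §4) pins the «local
  constants» to ONE vector; the asymptotic form of KNSS Rem. 6.1 / Seregin 2014 p.113 («c(t) mild ⟺ c const»).

KERNEL RESULTS: `quiescentLiouville_iff_cells` (L_Q ⟺ BCL ∧ LSL, exact), `globallyFadingLiouville_iff_bcl`
(the special CELL is literally the door), `liouvilleL_iff_three_doors` ((L) ⟺ EL ∧ BCL ∧ LSL, unconditional),
`typeIAncientLiouville_of_bcl` (BCL ⟹ stmt-4050 by name: door order), `closes_root_typeI` / `closes_root_pace`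
(summit by name, other open cruxes carried as binders), strata `Type-I ⊂ BC ⊂ GF ⊂ quiescent` (§2).
No `sorry`, no new axioms, no `def`/`abbrev`/`instance`/`notation`.
-/

noncomputable section
open MeasureTheory Filter Set Function Metric
open scoped Topology
open Literature.Analysis Literature.Analysis.FluidPDE Literature.Analysis.UnboundedOperators
open Summit.NavierStokesRegularity.NavierStokesRegularity
namespace Summit.NavierStokesRegularity.NavierStokesRegularity.Theorems.TypeILiouvilleGlobalFading

/-! ## §1 The momentum anchor -/

section Anchor

variable {v : ℝ → EuclideanSpace ℝ (Fin 3) → EuclideanSpace ℝ (Fin 3)}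

/-- **Conservation of momentum at spatial infinity for print's class** (specialisation of the landed
`Theorems.stub_oseen_ball_average_momentum`, KNSS 2009 §4): for `s < t < 0` the ball averages of
`v(t) − v(s)` over `B_R(0)` tend to `0` as `R → ∞`. The field is truncated to `0` on `t ≥ 0` to obtain a
jointly measurable field; the Oseen–Duhamel term only sees times in `(s,t)`. -/
theorem tendsto_ballAverage_sub
    (hcont : ContinuousOn (uncurry v) (Iio 0 ×ˢ univ))
    (hbdd : ∃ K : ℝ, ∀ t < 0, ∀ x, ‖v t x‖ ≤ K)
    (hmild : ∀ s t : ℝ, s < t → t < 0 → ∀ x,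
      v t x = Literature.Analysis.UnboundedOperators.heatExtension (v s) (t - s) x -
        Literature.Analysis.FluidPDE.oseenDuhamel 1 s v v t x)
    {s t : ℝ} (hst : s < t) (ht : t < 0) :
    Tendsto (fun R : ℝ => ⨍ x in Metric.ball (0 : EuclideanSpace ℝ (Fin 3)) R, (v t x - v s x))
      atTop (𝓝 0) := by
  classical
  obtain ⟨K, hK⟩ := hbdd
  -- truncation: a jointly measurable field agreeing with `v` on `t < 0`
  set V : ℝ → EuclideanSpace ℝ (Fin 3) → EuclideanSpace ℝ (Fin 3) :=
    fun τ x => if τ < 0 then v τ x else 0 with hV_def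
  have hVeq : ∀ τ < 0, V τ = v τ := by
    intro τ hτ; funext x; simp [hV_def, hτ]
  have hVpiece : uncurry V = (Iio (0 : ℝ) ×ˢ (univ : Set (EuclideanSpace ℝ (Fin 3)))).piecewise
      (uncurry v) 0 := by
    funext p
    rcases p with ⟨τ, x⟩
    by_cases hτ : τ < 0
    · have hp : (τ, x) ∈ Iio (0 : ℝ) ×ˢ (univ : Set (EuclideanSpace ℝ (Fin 3))) :=
        mem_prod.2 ⟨hτ, mem_univ _⟩
      simp [hV_def, hτ, Set.piecewise, hp]
    · have hp : (τ, x) ∉ Iio (0 : ℝ) ×ˢ (univ : Set (EuclideanSpace ℝ (Fin 3))) := by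
        intro h; exact hτ (mem_prod.1 h).1
      simp [hV_def, hτ, Set.piecewise, hp]
  have hVm : Measurable (uncurry V) := by
    rw [hVpiece]
    exact hcont.measurable_piecewise continuousOn_const (measurableSet_Iio.prod MeasurableSet.univ)
  have hVb : ∀ σ ∈ Icc s t, ∀ y, ‖V σ y‖ ≤ K := by
    intro σ hσ y
    have hσ0 : σ < 0 := lt_of_le_of_lt hσ.2 ht
    rw [hVeq σ hσ0]; exact hK σ hσ0 y
  have h := Theorems.stub_oseen_ball_average_momentum V K s t hst hVm hVb
  refine h.congr' (Eventually.of_forall fun R => ?_)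
  refine setAverage_congr_fun measurableSet_ball (Eventually.of_forall fun x _ => ?_)
  have hs0 : s < 0 := hst.trans ht
  have hD : oseenDuhamel 1 s V V t x = oseenDuhamel 1 s v v t x :=
    LongLivedOseenSolution.oseenDuhamel_congr
      (fun τ hτ => hVeq τ (hτ.2.trans ht)) (fun τ hτ => hVeq τ (hτ.2.trans ht)) x
  rw [hVeq s hs0, hD, hmild s t hst ht x]
  abel

/-- **The two-slice anchor.** If the slices at `s < t < 0` have global oscillation at most `θs`,
`θt`, then every point value moves by at most `θt + θs` between them: momentum conservation at
infinity pins the «local constant». -/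
theorem norm_sub_le_of_oscillation
    (hcont : ContinuousOn (uncurry v) (Iio 0 ×ˢ univ))
    (hbdd : ∃ K : ℝ, ∀ t < 0, ∀ x, ‖v t x‖ ≤ K)
    (hmild : ∀ s t : ℝ, s < t → t < 0 → ∀ x,
      v t x = Literature.Analysis.UnboundedOperators.heatExtension (v s) (t - s) x -
        Literature.Analysis.FluidPDE.oseenDuhamel 1 s v v t x)
    {s t : ℝ} (hst : s < t) (ht : t < 0) {θs θt : ℝ}
    (hθs : ∀ x y, ‖v s x - v s y‖ ≤ θs) (hθt : ∀ x y, ‖v t x - v t y‖ ≤ θt)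
    (x₀ : EuclideanSpace ℝ (Fin 3)) :
    ‖v t x₀ - v s x₀‖ ≤ θt + θs := by
  have hlim := (tendsto_ballAverage_sub hcont hbdd hmild hst ht).norm
  rw [norm_zero] at hlim
  have hev : ∀ᶠ R : ℝ in atTop, ‖v t x₀ - v s x₀‖ ≤
      ‖⨍ x in Metric.ball (0 : EuclideanSpace ℝ (Fin 3)) R, (v t x - v s x)‖ + (θt + θs) := by
    filter_upwards [eventually_gt_atTop (0 : ℝ)] with R hR
    set B : Set (EuclideanSpace ℝ (Fin 3)) := Metric.ball 0 R
    have hBpos : 0 < (volume : Measure (EuclideanSpace ℝ (Fin 3))).real B :=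
      ENNReal.toReal_pos (Metric.measure_ball_pos volume _ hR).ne' measure_ball_lt_top.ne
    have hBlt : (volume : Measure (EuclideanSpace ℝ (Fin 3))) B < ⊤ := measure_ball_lt_top
    -- integrability of `v t - v s` and of constants on the ball (continuous bounded slices)
    obtain ⟨K, hK⟩ := hbdd
    have hs0 : s < 0 := hst.trans ht
    have hct : Continuous (v t) :=
      hcont.comp_continuous (Continuous.prodMk_right t) fun x => mem_prod.2 ⟨ht, mem_univ x⟩
    have hcs : Continuous (v s) :=
      hcont.comp_continuous (Continuous.prodMk_right s) fun x => mem_prod.2 ⟨hs0, mem_univ x⟩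
    have hfi : Integrable (fun x => v t x - v s x)
        ((volume : Measure (EuclideanSpace ℝ (Fin 3))).restrict B) :=
      Measure.integrableOn_of_bounded (M := K + K) hBlt.ne (hct.sub hcs).aestronglyMeasurable
        (ae_of_all _ fun x => (norm_sub_le _ _).trans (add_le_add (hK t ht x) (hK s hs0 x)))
    have hci : Integrable (fun _ : EuclideanSpace ℝ (Fin 3) => v t x₀ - v s x₀)
        ((volume : Measure (EuclideanSpace ℝ (Fin 3))).restrict B) :=
      integrableOn_const hBlt.ne
    have hsub := integral_sub hfi hci
    have hcI : ∫ _ in B, (v t x₀ - v s x₀) =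
        (volume : Measure (EuclideanSpace ℝ (Fin 3))).real B • (v t x₀ - v s x₀) :=
      setIntegral_const _
    have hI : ‖∫ x in B, ((v t x - v s x) - (v t x₀ - v s x₀))‖ ≤
        (θt + θs) * (volume : Measure (EuclideanSpace ℝ (Fin 3))).real B := by
      refine norm_setIntegral_le_of_norm_le_const hBlt fun x _ => ?_
      calc ‖v t x - v s x - (v t x₀ - v s x₀)‖ = ‖(v t x - v t x₀) - (v s x - v s x₀)‖ := by
            congr 1; abel
        _ ≤ ‖v t x - v t x₀‖ + ‖v s x - v s x₀‖ := norm_sub_le _ _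
        _ ≤ θt + θs := add_le_add (hθt x x₀) (hθs x x₀)
    have key : (⨍ x in B, (v t x - v s x)) - (v t x₀ - v s x₀) =
        ((volume : Measure (EuclideanSpace ℝ (Fin 3))).real B)⁻¹ •
          ∫ x in B, ((v t x - v s x) - (v t x₀ - v s x₀)) := by
      rw [hsub, hcI, smul_sub, inv_smul_smul₀ hBpos.ne', setAverage_eq]
    have hdiff : ‖(⨍ x in B, (v t x - v s x)) - (v t x₀ - v s x₀)‖ ≤ θt + θs := by
      rw [key, norm_smul, Real.norm_of_nonneg (inv_nonneg.2 hBpos.le)]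
      calc ((volume : Measure (EuclideanSpace ℝ (Fin 3))).real B)⁻¹ *
            ‖∫ x in B, ((v t x - v s x) - (v t x₀ - v s x₀))‖
            ≤ ((volume : Measure (EuclideanSpace ℝ (Fin 3))).real B)⁻¹ *
              ((θt + θs) * (volume : Measure (EuclideanSpace ℝ (Fin 3))).real B) :=
            mul_le_mul_of_nonneg_left hI (inv_nonneg.2 hBpos.le)
        _ = θt + θs := by field_simp
    calc ‖v t x₀ - v s x₀‖ = ‖(⨍ x in B, (v t x - v s x)) -
          ((⨍ x in B, (v t x - v s x)) - (v t x₀ - v s x₀))‖ := by congr 1; abel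
      _ ≤ ‖⨍ x in B, (v t x - v s x)‖ + ‖(⨍ x in B, (v t x - v s x)) - (v t x₀ - v s x₀)‖ :=
          norm_sub_le _ _
      _ ≤ _ := add_le_add le_rfl hdiff
  have hlim' : Tendsto (fun R : ℝ =>
      ‖⨍ x in Metric.ball (0 : EuclideanSpace ℝ (Fin 3)) R, (v t x - v s x)‖ + (θt + θs))
      atTop (𝓝 (0 + (θt + θs))) := hlim.add_const _
  rw [zero_add] at hlim'
  exact ge_of_tendsto hlim' hev

/-- Symmetric form of the two-slice anchor (any two negative times). -/
theorem norm_sub_le_of_oscillation'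
    (hcont : ContinuousOn (uncurry v) (Iio 0 ×ˢ univ))
    (hbdd : ∃ K : ℝ, ∀ t < 0, ∀ x, ‖v t x‖ ≤ K)
    (hmild : ∀ s t : ℝ, s < t → t < 0 → ∀ x,
      v t x = Literature.Analysis.UnboundedOperators.heatExtension (v s) (t - s) x -
        Literature.Analysis.FluidPDE.oseenDuhamel 1 s v v t x)
    {s t : ℝ} (hs : s < 0) (ht : t < 0) {θ : ℝ}
    (hθs : ∀ x y, ‖v s x - v s y‖ ≤ θ) (hθt : ∀ x y, ‖v t x - v t y‖ ≤ θ)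
    (x₀ : EuclideanSpace ℝ (Fin 3)) :
    ‖v t x₀ - v s x₀‖ ≤ θ + θ := by
  rcases lt_trichotomy s t with hst | rfl | hts
  · exact norm_sub_le_of_oscillation hcont hbdd hmild hst ht hθs hθt x₀
  · have h0 : 0 ≤ θ := (norm_nonneg _).trans (hθs x₀ x₀)
    simp only [sub_self, norm_zero]; positivity
  · rw [norm_sub_rev]
    exact norm_sub_le_of_oscillation hcont hbdd hmild hts hs hθt hθs x₀

/-- **THE MOMENTUM ANCHOR (new theorem of this node): GLOBAL FADING ⟹ BACKWARD CONVERGENCE.** If the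
global oscillation of the slices tends to `0` as `t → −∞`, then the slices converge UNIFORMLY to ONE
constant vector `c`: the «local constants» cannot wander, because the mean velocity at spatial infinity
is conserved (KNSS 2009 §4; tree `stub_oseen_ball_average_momentum`). This is the asymptotic form of
KNSS's Remark 6.1 / Seregin 2014 p. 113 («`c(t)` is mild iff `c(t) ≡ const`»). -/
theorem backwardConvergent_of_globallyFading
    (hcont : ContinuousOn (uncurry v) (Iio 0 ×ˢ univ))
    (hbdd : ∃ K : ℝ, ∀ t < 0, ∀ x, ‖v t x‖ ≤ K)
    (hmild : ∀ s t : ℝ, s < t → t < 0 → ∀ x,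
      v t x = Literature.Analysis.UnboundedOperators.heatExtension (v s) (t - s) x -
        Literature.Analysis.FluidPDE.oseenDuhamel 1 s v v t x)
    (hGF : ∀ θ : ℝ, 0 < θ → ∃ T : ℝ, T < 0 ∧ ∀ t < T, ∀ x y : EuclideanSpace ℝ (Fin 3),
      ‖v t x - v t y‖ ≤ θ) :
    ∃ c : EuclideanSpace ℝ (Fin 3), ∀ η : ℝ, 0 < η → ∃ T : ℝ, T < 0 ∧ ∀ t < T, ∀ x,
      ‖v t x - c‖ ≤ η := by
  -- the values at the origin along `t = -(n+1)` form a Cauchy sequence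
  set u : ℕ → EuclideanSpace ℝ (Fin 3) := fun n => v (-(n : ℝ) - 1) 0 with hu_def
  have hneg : ∀ n : ℕ, (-(n : ℝ) - 1) < 0 := fun n => by
    have : (0 : ℝ) ≤ n := Nat.cast_nonneg n
    linarith
  have two_slice : ∀ θ : ℝ, 0 < θ → ∃ T : ℝ, T < 0 ∧ ∀ s < T, ∀ t < T,
      ‖v t 0 - v s 0‖ ≤ θ + θ := by
    intro θ hθ
    obtain ⟨T, hT0, hT⟩ := hGF θ hθ
    exact ⟨T, hT0, fun s hs t ht => norm_sub_le_of_oscillation' hcont hbdd hmild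
      (hs.trans hT0) (ht.trans hT0) (hT s hs) (hT t ht) 0⟩
  have hu : CauchySeq u := by
    refine Metric.cauchySeq_iff.2 fun ε hε => ?_
    obtain ⟨T, hT0, hT⟩ := two_slice (ε / 3) (by positivity)
    refine ⟨⌈-T⌉₊, fun m hm n hn => ?_⟩
    have hmT : (-(m : ℝ) - 1) < T := by
      have : (-T : ℝ) ≤ m := (Nat.le_ceil (-T)).trans (by exact_mod_cast hm)
      linarith
    have hnT : (-(n : ℝ) - 1) < T := by
      have : (-T : ℝ) ≤ n := (Nat.le_ceil (-T)).trans (by exact_mod_cast hn)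
      linarith
    rw [dist_eq_norm]
    calc ‖u m - u n‖ ≤ ε / 3 + ε / 3 := hT _ hnT _ hmT
      _ < ε := by linarith
  obtain ⟨c, hc⟩ := cauchySeq_tendsto_of_complete hu
  refine ⟨c, fun η hη => ?_⟩
  obtain ⟨T₁, hT₁0, hT₁⟩ := hGF (η / 4) (by positivity)
  obtain ⟨T₂, hT₂0, hT₂⟩ := two_slice (η / 4) (by positivity)
  refine ⟨min T₁ T₂, (min_le_left _ _).trans_lt hT₁0, fun t ht x => ?_⟩
  have ht₁ : t < T₁ := lt_of_lt_of_le ht (min_le_left _ _)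
  have ht₂ : t < T₂ := lt_of_lt_of_le ht (min_le_right _ _)
  -- choose `n` with `u n` close to `c` and `-(n+1) < T₂`
  have hev₁ : ∀ᶠ n : ℕ in atTop, dist (u n) c < η / 4 :=
    (Metric.tendsto_nhds.1 hc) (η / 4) (by positivity)
  have hev₂ : ∀ᶠ n : ℕ in atTop, (-(n : ℝ) - 1) < T₂ := by
    filter_upwards [eventually_ge_atTop ⌈-T₂⌉₊] with n hn
    have : (-T₂ : ℝ) ≤ n := (Nat.le_ceil (-T₂)).trans (by exact_mod_cast hn)
    linarith
  obtain ⟨n, hn₁, hn₂⟩ := (hev₁.and hev₂).exists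
  rw [dist_eq_norm] at hn₁
  calc ‖v t x - c‖ = ‖(v t x - v t 0) + (v t 0 - u n) + (u n - c)‖ := by
        simp only [hu_def]; congr 1; abel
    _ ≤ ‖v t x - v t 0‖ + ‖v t 0 - u n‖ + ‖u n - c‖ := norm_add₃_le
    _ ≤ η / 4 + (η / 4 + η / 4) + η / 4 :=
        add_le_add (add_le_add (hT₁ t ht₁ x 0) (hT₂ _ hn₂ _ ht₂)) hn₁.le
    _ = η := by ring

end Anchor

/-! ## §2 Kernel inclusions between the strata: Type-I ⊂ backward-convergent ⊂ globally fading ⊂ quiescent -/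

section Strata

variable {v : ℝ → EuclideanSpace ℝ (Fin 3) → EuclideanSpace ℝ (Fin 3)}

/-- A backward-convergent field is globally fading (triangle inequality). -/
theorem globallyFading_of_backwardConvergent
    (hBC : ∃ c : EuclideanSpace ℝ (Fin 3), ∀ η : ℝ, 0 < η → ∃ T : ℝ, T < 0 ∧ ∀ t < T, ∀ x,
        ‖v t x - c‖ ≤ η) :
    ∀ θ : ℝ, 0 < θ → ∃ T : ℝ, T < 0 ∧ ∀ t < T, ∀ x y : EuclideanSpace ℝ (Fin 3),
      ‖v t x - v t y‖ ≤ θ := by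
  intro θ hθ
  obtain ⟨c, hc⟩ := hBC
  obtain ⟨T, hT0, hT⟩ := hc (θ / 2) (by positivity)
  refine ⟨T, hT0, fun t ht x y => ?_⟩
  calc ‖v t x - v t y‖ = ‖(v t x - c) - (v t y - c)‖ := by congr 1; abel
    _ ≤ ‖v t x - c‖ + ‖v t y - c‖ := norm_sub_le _ _
    _ ≤ θ / 2 + θ / 2 := add_le_add (hT t ht x) (hT t ht y)
    _ = θ := by ring

/-- A globally fading field has a quiescent past (the unit-distance constraint is simply dropped). -/
theorem quiescent_of_globallyFading
    (hGF : ∀ θ : ℝ, 0 < θ → ∃ T : ℝ, T < 0 ∧ ∀ t < T, ∀ x y : EuclideanSpace ℝ (Fin 3),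
      ‖v t x - v t y‖ ≤ θ) :
    ∀ ε : ℝ, 0 < ε → ∃ T : ℝ, T < 0 ∧ ∀ t < T, ∀ x y : EuclideanSpace ℝ (Fin 3),
      dist x y ≤ 1 → ‖v t x - v t y‖ ≤ ε := by
  intro ε hε
  obtain ⟨T, hT0, hT⟩ := hGF ε hε
  exact ⟨T, hT0, fun t ht x y _ => hT t ht x y⟩

/-- The Type-I regime (`‖v(t,x)‖ ≤ C/√(−t)`, the class of door stmt-4050) is backward-convergent
(to `c = 0`). -/
theorem backwardConvergent_of_typeI
    (hI : ∃ C : ℝ, ∀ t < 0, ∀ x, ‖v t x‖ ≤ C / Real.sqrt (-t)) :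
    ∃ c : EuclideanSpace ℝ (Fin 3), ∀ η : ℝ, 0 < η → ∃ T : ℝ, T < 0 ∧ ∀ t < T, ∀ x,
      ‖v t x - c‖ ≤ η := by
  obtain ⟨C, hC⟩ := hI
  refine ⟨0, fun η hη => ⟨-((C / η) ^ 2) - 1, by nlinarith [sq_nonneg (C / η)], fun t ht x => ?_⟩⟩
  rw [sub_zero]
  have ht0 : t < 0 := by nlinarith [sq_nonneg (C / η)]
  refine (hC t ht0 x).trans ?_
  have hsq : (C / η) ^ 2 < -t := by linarith
  have hroot : |C / η| < Real.sqrt (-t) := by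
    rw [← Real.sqrt_sq_eq_abs]
    exact Real.sqrt_lt_sqrt (sq_nonneg _) hsq
  have hpos : 0 < Real.sqrt (-t) := Real.sqrt_pos.2 (by linarith)
  rw [div_le_iff₀ hpos]
  calc C ≤ |C| := le_abs_self C
    _ = |C / η| * η := by rw [abs_div, abs_of_pos hη, div_mul_cancel₀ _ hη.ne']
    _ ≤ Real.sqrt (-t) * η := by nlinarith [hroot, hη]
    _ = η * Real.sqrt (-t) := mul_comm _ _

end Strata

/-! ## §2b The residual's length scale: quiescence + global stirring forces LARGE-SCALE stirring -/

section Separation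

/-- Chain estimate: if `w` oscillates by at most `ε` on every pair at distance `≤ 1`, then on an
arbitrary pair it oscillates by at most `ε · (dist x y + 1)` (walk along the segment in `⌈dist x y⌉`
unit steps). -/
theorem norm_sub_le_mul_dist_add_one {w : EuclideanSpace ℝ (Fin 3) → EuclideanSpace ℝ (Fin 3)}
    {ε : ℝ} (hε : 0 ≤ ε)
    (hq : ∀ x y : EuclideanSpace ℝ (Fin 3), dist x y ≤ 1 → ‖w x - w y‖ ≤ ε)
    (x y : EuclideanSpace ℝ (Fin 3)) :
    ‖w x - w y‖ ≤ ε * (dist x y + 1) := by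
  set N : ℕ := ⌈dist x y⌉₊ with hN_def
  have hNle : dist x y ≤ N := Nat.le_ceil _
  have hNlt : (N : ℝ) < dist x y + 1 := Nat.ceil_lt_add_one dist_nonneg
  rcases Nat.eq_zero_or_pos N with hN0 | hNpos
  · have hxy : x = y := by
      have : dist x y ≤ 0 := by simpa [hN0] using hNle
      exact dist_le_zero.1 this
    subst hxy
    simp only [sub_self, norm_zero, dist_self, zero_add, mul_one]
    exact hε
  -- the chain of points along the segment
  set p : ℕ → EuclideanSpace ℝ (Fin 3) := fun j => x + ((j : ℝ) / N) • (y - x) with hp_def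
  have hNR : (0 : ℝ) < N := by exact_mod_cast hNpos
  have hp0 : p 0 = x := by simp [hp_def]
  have hpN : p N = y := by
    simp only [hp_def, div_self hNR.ne', one_smul]
    abel
  have hstep : ∀ j : ℕ, dist (p (j + 1)) (p j) ≤ 1 := by
    intro j
    rw [dist_eq_norm]
    have : p (j + 1) - p j = ((1 : ℝ) / N) • (y - x) := by
      simp only [hp_def, Nat.cast_add, Nat.cast_one]
      rw [show x + (((j : ℝ) + 1) / N) • (y - x) - (x + ((j : ℝ) / N) • (y - x)) =
          (((j : ℝ) + 1) / N - (j : ℝ) / N) • (y - x) by rw [sub_smul]; abel]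
      congr 1
      field_simp
      ring
    rw [this, norm_smul, norm_div, norm_one, Real.norm_of_nonneg hNR.le, ← dist_eq_norm, dist_comm,
      one_div, inv_mul_le_iff₀ hNR, mul_one]
    exact hNle
  have htel : w y - w x = ∑ j ∈ Finset.range N, (w (p (j + 1)) - w (p j)) := by
    rw [Finset.sum_range_sub (fun j => w (p j)), hpN, hp0]
  calc ‖w x - w y‖ = ‖w y - w x‖ := norm_sub_rev _ _
    _ = ‖∑ j ∈ Finset.range N, (w (p (j + 1)) - w (p j))‖ := by rw [htel]
    _ ≤ ∑ j ∈ Finset.range N, ‖w (p (j + 1)) - w (p j)‖ := norm_sum_le _ _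
    _ ≤ ∑ _j ∈ Finset.range N, ε := Finset.sum_le_sum fun j _ => hq _ _ (hstep j)
    _ = N * ε := by simp
    _ ≤ ε * (dist x y + 1) := by nlinarith

/-- **Length scale of the residual.** On a slice with unit-scale oscillation `≤ ε`, a STIRRING PAIR
(`θ < ‖v x − v y‖`) is separated: `θ < ε · (dist x y + 1)`, i.e. `dist x y > θ/ε − 1`. Along the
residual's globally-stirred far past (`ε = ε(t) → 0`, `θ` fixed) the stirring therefore lives at spatial
separation `ℓ(t) ≥ θ/ε(t) − 1 → ∞`: «LOCALLY FADING, GLOBALLY STIRRED» = LARGE-SCALE STIRRING. -/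
theorem stirring_separation {w : EuclideanSpace ℝ (Fin 3) → EuclideanSpace ℝ (Fin 3)}
    {ε θ : ℝ} (hε : 0 ≤ ε)
    (hq : ∀ x y : EuclideanSpace ℝ (Fin 3), dist x y ≤ 1 → ‖w x - w y‖ ≤ ε)
    {x y : EuclideanSpace ℝ (Fin 3)} (hθ : θ < ‖w x - w y‖) :
    θ < ε * (dist x y + 1) :=
  hθ.trans_le (norm_sub_le_mul_dist_add_one hε hq x y)

end Separation

end Summit.NavierStokesRegularity.NavierStokesRegularity.Theorems.TypeILiouvilleGlobalFading

end
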